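import Summits.HodgeConjecture.HodgeConjecture.Theorems.MarkmanPartnerTransportK3Sq2TypeHodgeOfCycleInducedGenerators
import Literature.AlgebraicGeometry.HodgeTheory.GysinBaseChange
import Literature.AlgebraicGeometry.HodgeTheory.CorrespondenceComposition
import Literature.AlgebraicGeometry.HodgeTheory.KunnethComponentsDiagonalAction

/-!
# Route MarkmanPartnerTransport · the `X`-side rung F4: HC⁴(X) for a marked `K3^{[2]}`-type fourfold whose
# transcendental Hodge endomorphisms are generated by ONE CYCLE-INDUCED endomorphism (crux #5, any rank)

Consumer of the cycle-induced sector `hodgeConjectureFor_of_spannedByCycleInduced`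
(`…K3Sq2TypeHodgeOfCycleInducedGenerators`). For the real-multiplication residue of crux #5
`LowPicardRealMultiplication` (`E = End_Hdg T(X)` totally real, `E = ℚ[t]`) one needs the POWERS of a
cycle-induced generator `t = [Z]_*` to be cycle-induced — composition of algebraic correspondences on the
eightfold `X × X` (Fulton, Prop. 16.1.1; Buskin, Lemma 6.3), which the tree supplies for all dimensions
modulo nothing: `corr_comp_of_baseChange` with the PROVED base change `gysin_baseChange`, and
`corrCompClass_mem_algebraicClasses` with the multiplicativity of algebraic classes (a tree theorem,
`Theorems.Voisin2003_cupProduct_algebraicClasses_holds`); the identity is the diagonal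
(`corrAction_diagonalClass_apply`, `diagonalClass_mem_algebraicClasses`).

* `exists_corrAction_comp_fourfold` — for `Z, Z' ∈ A⁴(X × X)` there is `Z'' ∈ A⁴(X × X)` with
  `[Z'']_* = [Z]_* ∘ [Z']_*` on `H²(X)` (complex orientations);
* `exists_corrAction_pow` — the powers of a cycle-induced endomorphism of `H²(X)` are cycle-induced;
* `hodgeConjectureFor_of_cycleInducedGenerator` — **the `X`-side F4**: for a marked smooth projective
  `K3^{[2]}`-type `X` and a rational, type-preserving endomorphism `t = [Z]_*` of `H²(X)` (`Z ∈ A⁴(X × X)`) such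
  that every rational Hodge endomorphism of `H²(X)` killing `N¹(X)` with transcendental image is a RATIONAL
  POLYNOMIAL in `t` on `T(X)` (`End_Hdg(T(X)_ℚ) = ℚ[t|_T]`, e.g. real multiplication by `ℚ[t]`), HC⁴(X) holds,
  modulo {Verbitsky–Guan, O'Grady, `QInvAlgebraic`} (`…_of_charlesMarkman`: modulo {Verbitsky–Guan, O'Grady,
  Charles–Markman 2013}). Partner-free, every Picard rank — in particular inside the regime `ρ(X) ≤ 3` of crux
  #5, whose open content thereby reads: «a generator of the real-multiplication field of `T(X)` is induced by
  an algebraic class on `X × X`» — the statement an `X`-side spread line would deliver componentwise.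

CONDITIONAL on the named facts displayed; no definition, no sorry. Prover seat hodge-nonav-19652-p1 (gen 7),
`--supports stmt-HodgeConjecture-19653`. Nothing here proves the crux, the target, or HC.

References: W. Fulton, *Intersection Theory* §16.1 Prop. 16.1.1; N. Buskin, J. reine angew. Math. 755 (2019)
Lemma 6.3; E. Markman, Compos. Math. 160 (2024) Thm. 1.1; M. Varesco, Math. Z. 305 (2023) §2; C. Voisin,
*Hodge Theory II*, Prop. 9.20, Thm. 10.17.
-/

noncomputable section

set_option linter.dupNamespace false

open Module CategoryTheory MonoidalCategory CartesianMonoidalCategory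
open Literature.AlgebraicTopology.SingularHomology Literature.Geometry.Kaehler
open Literature.AlgebraicGeometry Literature.AlgebraicGeometry.Motives Literature.AlgebraicGeometry.HodgeTheory
open Literature.AlgebraicGeometry.Hyperkaehler Literature.AlgebraicGeometry.Surfaces
open Summit.HodgeConjecture.HodgeConjecture.Theorems.NikulinTwinTransport
open Summit.HodgeConjecture.HodgeConjecture.Theorems.MarkmanPartnerTransport.BBFPositivity

namespace Summit.HodgeConjecture.HodgeConjecture.Theorems.MarkmanPartnerTransport.PartnerLattice

/-- `MarkedK3Sq[X, φ, P, z]`: VERBATIM the `let MarkedK3Sq := …` binder of the route declarations of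
MarkmanPartnerTransport (clauses (m1)–(m6)). Local notation only. -/
local notation3 (prettyPrint := false) "MarkedK3Sq[" X ", " φ ", " P ", " z "]" =>
  (((IsIntegralClass P ∧ ∀ Q : complexBetti X (2 * 4), IsIntegralClass Q → ∃ n : ℤ, Q = n • P) ∧
    (∀ c : complexBetti X 2, IsIntegralClass c ↔ ∃ v : K3HilbertIndex → ℤ, φ c = fun i => (v i : ℂ)) ∧
    (∀ a : complexBetti X 2, cupPowTwo a 4 = ((3 : ℂ) * (k3HilbertForm 2 (φ a) (φ a)) ^ 2) • P) ∧
    (IsOfHodgeType 4 X 2 2 0 (LinearEquiv.symm φ z) ∧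
      ∀ τ : complexBetti X 2, IsOfHodgeType 4 X 2 2 0 τ → ∃ t : ℂ, τ = t • LinearEquiv.symm φ z) ∧
    (∀ c : complexBetti X 2, IsOfHodgeType 4 X 2 1 1 c ↔
      (k3HilbertForm 2 (φ c) z = 0 ∧ k3HilbertForm 2 (φ c) (star z) = 0)) ∧
    (k3HilbertForm 2 z z = 0 ∧ 0 < (k3HilbertForm 2 (star z) z).re)))

variable {X : SchemeOver ℂ} {φ : complexBetti X 2 ≃ₗ[ℂ] (K3HilbertIndex → ℂ)} {P : complexBetti X (2 * 4)}
  {z : K3HilbertIndex → ℂ}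

/-! ### Composition of algebraic correspondences on a fourfold -/

/-- **Algebraic self-correspondences of a smooth projective fourfold compose** (Fulton Prop. 16.1.1 / Buskin
Lemma 6.3 in degree `(4,4)`): for `Z, Z' ∈ A⁴(X × X)` there is `Z'' ∈ A⁴(X × X)` — namely
`c • p₁₃_*(p₁₂^* Z ∪ p₂₃^* Z')` — with `[Z'']_* y = [Z]_*([Z']_* y)` for all `y ∈ H²(X(ℂ); ℂ)` (actions
`pr₁_*(pr₂^*(–) ∪ ·)` for the complex orientations). From the tree's `corr_comp_of_baseChange` with the PROVED
base change `gysin_baseChange`, and `corrCompClass_mem_algebraicClasses` with the PROVED multiplicativity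
`Theorems.Voisin2003_cupProduct_algebraicClasses_holds`. [cite: Fulton1998, §16.1 Prop. 16.1.1 and Def. 16.1.2]
[cite: Buskin2019, Lemma 6.3] -/
theorem exists_corrAction_comp_fourfold (hX : IsSmoothProjective 4 X)
    {Z : complexBetti (X ⊗ X) (2 * 4)} (hZ : Z ∈ algebraicClasses (X ⊗ X) 4)
    {Z' : complexBetti (X ⊗ X) (2 * 4)} (hZ' : Z' ∈ algebraicClasses (X ⊗ X) 4) :
    ∃ Z'' ∈ algebraicClasses (X ⊗ X) 4, ∀ y : complexBetti X 2,
      corrAction complexOrientationFamily hX hX (rfl : 2 + 2 * 4 = 2 + 2 * 4) Z'' y =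
        corrAction complexOrientationFamily hX hX (rfl : 2 + 2 * 4 = 2 + 2 * 4) Z
          (corrAction complexOrientationFamily hX hX (rfl : 2 + 2 * 4 = 2 + 2 * 4) Z' y) := by
  set μ : OrientationFamily := complexOrientationFamily with hμdef
  have hμ : μ.HasPoincareDuality := OrientationFamily.hasPoincareDuality μ
  obtain ⟨c, hc⟩ := gysin_baseChange μ hX hX hX (show 2 + 2 * 4 + 2 * 4 = 2 + 2 * (4 + 4) by norm_num)
  have hCUP : ∀ a ∈ algebraicClasses (X ⊗ (X ⊗ X)) 4, ∀ b ∈ algebraicClasses (X ⊗ (X ⊗ X)) 4,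
      cupProduct ((Nat.mul_add 2 4 4).symm : 2 * 4 + 2 * 4 = 2 * (4 + 4)) a b ∈
        algebraicClasses (X ⊗ (X ⊗ X)) (4 + 4) := fun a ha b hb =>
    Theorems.Voisin2003_cupProduct_algebraicClasses_holds
      (IsSmoothProjective.tensor_holds hX (IsSmoothProjective.tensor_holds hX hX)) ha hb
  refine ⟨c • complexGysin μ
      (IsSmoothProjective.tensor_holds hX (IsSmoothProjective.tensor_holds hX hX))
      (IsSmoothProjective.tensor_holds hX hX) (X ◁ snd X X)
      (show 2 * (4 + 4) + 2 * (4 + 4) = 2 * 4 + 2 * (4 + (4 + 4)) by omega)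
      (cupProduct ((Nat.mul_add 2 4 4).symm : 2 * 4 + 2 * 4 = 2 * (4 + 4))
        (complexBetti.map (X ◁ fst X X) (2 * 4) Z) (complexBetti.map (snd X (X ⊗ X)) (2 * 4) Z')),
    Submodule.smul_mem _ c (corrCompClass_mem_algebraicClasses hμ hX hX hX (e := 4) (e' := 4)
      (e'' := 4) rfl hCUP hZ hZ'), fun y ↦ ?_⟩
  rw [corrAction_apply, corrAction_apply, corrAction_apply]
  exact corr_comp_of_baseChange hμ hX hX hX (e := 4) (j := 2 * 4) (k := 2 * 4) (d := 2 * (4 + 4))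
    (a := 2) (a₁ := 2) (a₂ := 2) rfl rfl rfl ((Nat.mul_add 2 4 4).symm) Z Z' c hc y

/-- **Powers of a cycle-induced endomorphism of `H²(X)` are cycle-induced** (`X` a smooth projective fourfold,
complex orientations): `t = [Z]_*` with `Z ∈ A⁴(X × X)` ⟹ `tⁱ = [Zᵢ]_*` with `Zᵢ ∈ A⁴(X × X)` — `Z₀` the
diagonal (`corrAction_diagonalClass_apply`, `diagonalClass_mem_algebraicClasses`), `Z_{i+1} = Z ∘ Zᵢ`
(`exists_corrAction_comp_fourfold`). [cite: Fulton1998, §16.1 Prop. 16.1.1] [cite: VoisinHodgeI2002, §11.3.3 p. 287] -/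
theorem exists_corrAction_pow (hX : IsSmoothProjective 4 X) (t : complexBetti X 2 →ₗ[ℂ] complexBetti X 2)
    (ht : ∃ Z ∈ algebraicClasses (X ⊗ X) 4, ∀ y : complexBetti X 2,
      t y = corrAction complexOrientationFamily hX hX (rfl : 2 + 2 * 4 = 2 + 2 * 4) Z y) (i : ℕ) :
    ∃ Zi ∈ algebraicClasses (X ⊗ X) 4, ∀ y : complexBetti X 2,
      (t ^ i) y = corrAction complexOrientationFamily hX hX (rfl : 2 + 2 * 4 = 2 + 2 * 4) Zi y := by
  obtain ⟨Z, hZ, hZt⟩ := ht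
  induction i with
  | zero =>
    exact ⟨diagonalClass hX, diagonalClass_mem_algebraicClasses hX, fun y => by
      rw [pow_zero, Module.End.one_apply, corrAction_diagonalClass_apply hX]⟩
  | succ m ih =>
    obtain ⟨Zm, hZm, hm⟩ := ih
    obtain ⟨Z'', hZ'', hcomp⟩ := exists_corrAction_comp_fourfold hX hZ hZm
    exact ⟨Z'', hZ'', fun y => by rw [pow_succ', Module.End.mul_apply, hZt, hm, hcomp]⟩

/-! ### The `X`-side F4 -/

/-- **HC⁴(X) for a marked `K3^{[2]}`-type fourfold whose transcendental Hodge endomorphisms are generated by one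
cycle-induced endomorphism** (the `X`-side F4; crux #5's real-multiplication residue with a CYCLE-INDUCED
generator, partner-free, every Picard rank). Hypotheses: `t` rational, type-preserving, `t = [Z]_*` for an
algebraic `Z ∈ A⁴(X × X)`, and every rational Hodge endomorphism `f` of `H²(X)` killing `N¹(X)` with
transcendental image satisfies `f y = Σᵢ aᵢ tⁱ y` on `T(X)` with `aᵢ ∈ ℚ`. Then `SpannedByCycle` holds with the
powers `tⁱ` (rational, type-preserving, cycle-induced by `exists_corrAction_pow`) and
`hodgeConjectureFor_of_spannedByCycleInduced` concludes. Modulo {Verbitsky–Guan, O'Grady, `QInvAlgebraic`};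
the multiplicativity of algebraic classes is the tree's `Theorems.Voisin2003_cupProduct_algebraicClasses_holds`.
[cite: Varesco2023, §2 (p. 8)] [cite: Markman2024, §1.1 Thm. 1.1] [cite: Fulton1998, §16.1 Prop. 16.1.1] -/
theorem hodgeConjectureFor_of_cycleInducedGenerator
    (hV : VerbitskyGuan_cohomology_K3HilbertSquareType) (hO : OGrady2008_dualBBFClass_algebraic)
    (hQ : QInvAlgebraic) (hX : IsSmoothProjective 4 X) (hK : IsOfK3HilbertSquareType X) (hM : MarkedK3Sq[X, φ, P, z])
    (t : complexBetti X 2 →ₗ[ℂ] complexBetti X 2)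
    (ht_rat : ∀ y, IsRationalClass y → IsRationalClass (t y))
    (ht_typ : ∀ (a b : ℕ) y, IsOfHodgeType 4 X 2 a b y → IsOfHodgeType 4 X 2 a b (t y))
    (ht_cyc : ∃ Z ∈ algebraicClasses (X ⊗ X) 4, ∀ y : complexBetti X 2,
      t y = corrAction complexOrientationFamily hX hX (rfl : 2 + 2 * 4 = 2 + 2 * 4) Z y)
    (hgen : ∀ f : complexBetti X 2 →ₗ[ℂ] complexBetti X 2, (∀ y, IsRationalClass y → IsRationalClass (f y)) →
      (∀ (i j : ℕ) y, IsOfHodgeType 4 X 2 i j y → IsOfHodgeType 4 X 2 i j (f y)) →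
      (∀ d : complexBetti X 2, d ∈ algebraicClasses X 1 → f d = 0) →
      (∀ y : complexBetti X 2, ∀ d : complexBetti X 2, d ∈ algebraicClasses X 1 →
        k3HilbertForm 2 (φ (f y)) (φ d) = 0) →
      ∃ (n : ℕ) (a : Fin n → ℚ), ∀ y : complexBetti X 2,
        (∀ d : complexBetti X 2, d ∈ algebraicClasses X 1 → k3HilbertForm 2 (φ y) (φ d) = 0) →
        f y = ∑ i : Fin n, ((a i : ℂ) • (t ^ (i : ℕ)) y)) :
    HodgeConjectureFor 4 X := by
  refine hodgeConjectureFor_of_spannedByCycleInduced hV hO hQ Theorems.Voisin2003_cupProduct_algebraicClasses_holds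
    hX hK hM ?_
  intro f hfrat hfh hfN hfT
  obtain ⟨n, a, ha⟩ := hgen f hfrat hfh hfN hfT
  -- powers of `t` are rational and type-preserving
  have hpow_rat : ∀ (i : ℕ) y, IsRationalClass y → IsRationalClass ((t ^ i) y) := by
    intro i
    induction i with
    | zero => intro y hy; simpa using hy
    | succ m ih => intro y hy; rw [pow_succ', Module.End.mul_apply]; exact ht_rat _ (ih y hy)
  have hpow_typ : ∀ (i : ℕ) (a b : ℕ) y, IsOfHodgeType 4 X 2 a b y → IsOfHodgeType 4 X 2 a b ((t ^ i) y) := by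
    intro i
    induction i with
    | zero => intro a b y hy; simpa using hy
    | succ m ih => intro a b y hy; rw [pow_succ', Module.End.mul_apply]; exact ht_typ a b _ (ih a b y hy)
  exact ⟨n, a, fun i => t ^ (i : ℕ), fun i => ⟨hpow_rat i, hpow_typ i, exists_corrAction_pow hX t ht_cyc i⟩, ha⟩

/-- **The `X`-side F4 from the route's published facts**: as `hodgeConjectureFor_of_cycleInducedGenerator` with
`QInvAlgebraic` supplied by Charles–Markman 2013 + Verbitsky–Guan (`qInvAlgebraic_of_charlesMarkman`): HC⁴(X)
for a marked smooth projective `K3^{[2]}`-type `X` whose transcendental rational Hodge endomorphisms are the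
rational polynomials in one rational, type-preserving, CYCLE-INDUCED endomorphism `t` — modulo {Verbitsky–Guan,
O'Grady, Charles–Markman}. CONDITIONAL; credits nothing; crux #5 stays open (needed: the generator of the RM
field of a `K3^{[2]}`-type `X` with `ρ(X) ≤ 3` is cycle-induced). [cite: CharlesMarkman2013, Thm. 1.1 (§1)]
[cite: Markman2024, §1.1 Thm. 1.1] [cite: Varesco2023, §2 (p. 8)] -/
theorem hodgeConjectureFor_of_cycleInducedGenerator_of_charlesMarkman
    (hV : VerbitskyGuan_cohomology_K3HilbertSquareType) (hO : OGrady2008_dualBBFClass_algebraic)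
    (hB : CharlesMarkman2013_lefschetzStandard_K3HilbertType)
    (hX : IsSmoothProjective 4 X) (hK : IsOfK3HilbertSquareType X) (hM : MarkedK3Sq[X, φ, P, z])
    (t : complexBetti X 2 →ₗ[ℂ] complexBetti X 2)
    (ht_rat : ∀ y, IsRationalClass y → IsRationalClass (t y))
    (ht_typ : ∀ (a b : ℕ) y, IsOfHodgeType 4 X 2 a b y → IsOfHodgeType 4 X 2 a b (t y))
    (ht_cyc : ∃ Z ∈ algebraicClasses (X ⊗ X) 4, ∀ y : complexBetti X 2,
      t y = corrAction complexOrientationFamily hX hX (rfl : 2 + 2 * 4 = 2 + 2 * 4) Z y)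
    (hgen : ∀ f : complexBetti X 2 →ₗ[ℂ] complexBetti X 2, (∀ y, IsRationalClass y → IsRationalClass (f y)) →
      (∀ (i j : ℕ) y, IsOfHodgeType 4 X 2 i j y → IsOfHodgeType 4 X 2 i j (f y)) →
      (∀ d : complexBetti X 2, d ∈ algebraicClasses X 1 → f d = 0) →
      (∀ y : complexBetti X 2, ∀ d : complexBetti X 2, d ∈ algebraicClasses X 1 →
        k3HilbertForm 2 (φ (f y)) (φ d) = 0) →
      ∃ (n : ℕ) (a : Fin n → ℚ), ∀ y : complexBetti X 2,
        (∀ d : complexBetti X 2, d ∈ algebraicClasses X 1 → k3HilbertForm 2 (φ y) (φ d) = 0) →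
        f y = ∑ i : Fin n, ((a i : ℂ) • (t ^ (i : ℕ)) y)) :
    HodgeConjectureFor 4 X :=
  hodgeConjectureFor_of_cycleInducedGenerator hV hO (qInvAlgebraic_of_charlesMarkman hV hB) hX hK hM t ht_rat
    ht_typ ht_cyc hgen

end Summit.HodgeConjecture.HodgeConjecture.Theorems.MarkmanPartnerTransport.PartnerLattice
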